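import Summits.CriticalPhenomena.PercolationContinuityZ3.Theorems.Transplant.SkelPhiSideForm
import Summits.CriticalPhenomena.PercolationContinuityZ3.Theorems.Transplant.SkelPhiParaRunDisp
import HarnessLib

/-!
# N1 (the `{±1}` node), LEVEL 1, kit adapter file N-K6a: THE SIDE FORMS OF THE RUN FRAMES — every side of a box of the x-run frame
# `runX φ c₀ n h σ = (σα_rel, ⌊σβ′/U⌋)` (and of `runY`, coordinates exchanged) is a sharp half-plane of the base chart: raw sides
# `{∓σα ≥ θ}`, level sides `{∓σβ′ ≥ θ}` (`β′ = nβ − hα`, `U = n + |h|`); plus the `Compat`-type control of the run frames by `φ`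

builds on p205010 (kernel theorem, internal audit signed; external expert review pending) — nothing in this file uses p205010; nothing here is a
claim about the open node `SamePDropOfSkeletonNeg`.
Lane `prim-bschramm`, seat `prim-bschramm-p1` (gen 11; design KIT-APRON-N1); helper file (`--supports stmt-CriticalPhenomena-4575 --as helper`).
* §1 `sgnU` (the unit `σ`), the raw side form `rawSide` and the level side form `levSide` of `runX`, **`runXSide`** (all four), **`runYSide`**;
  the thresholds are affine: `θ_raw m = m + const`, `θ_lev m = U·m + const` (`rawSide_θ`, `levSide_θ`), coefficients `(∓σ, 0)` / `(±σh, ∓σn)`;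
* §2 `compat_runX`, `compat_runY` (a `φ`-box of radius `d` moves the frame by `≤ d + 1`).
[cite: MartineauTassion2017, §3 (the sheared coordinates (x, y′))] [cite: KozmaNitzan2024, §4 p. 21]
-/

noncomputable section

open scoped Classical

namespace Summit.CriticalPhenomena.PercolationContinuityZ3.Theorems.Transplant

namespace Skelφ

open Literature.Probability.Percolation Literature.Probability.LatticeModels SimpleGraph
open Literature.Probability.Percolation.KozmaNitzan.Cells (oth oth_ne eq_oth_of_ne oth_oth)

variable {V : Type} {φ : V → Site 2}

/-! ## §1 The side forms of the run frames -/

/-- The sign `σ = ±1` as a unit. [folklore] -/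
def sgnU (σ : ℤ) : ℤˣ := if σ = 1 then 1 else -1

/-- `sgnU σ = σ` for `σ = ±1`. [folklore] -/
theorem val_sgnU {σ : ℤ} (hσ : σ = 1 ∨ σ = -1) : (sgnU σ : ℤ) = σ := by
  unfold sgnU; rcases hσ with rfl | rfl <;> simp

/-- **The raw side form** of the side `(i, σ₀)` of a box in a frame whose coordinate `i` is `σ(α − α₀)`: `L = −σ₀σ·α`,
`θ m = m ∓ (face) − σ₀σα₀`. [this work] -/
def rawSide (ψ : V → Site 2) (c₀ : V) (σ : ℤ) (hσ : σ = 1 ∨ σ = -1) (Lo Hi : Site 2) (i : Fin 2) (σ₀ : ℤˣ)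
    (hraw : ∀ w, ψ w i = σ * (φ w 0 - φ c₀ 0)) : SideForm ψ φ Lo Hi i σ₀ where
  cα := -((σ₀ : ℤ) * σ)
  cβ := 0
  θ := fun m => m + (if (σ₀ : ℤ) = 1 then -Hi i else Lo i) - (σ₀ : ℤ) * σ * φ c₀ 0
  a := 0
  s := -(σ₀ * sgnU σ)
  clim := by
    have hs := val_sgnU hσ
    have h1 : (σ₀ : ℤ) * (σ₀ : ℤ) = 1 := by rcases Int.units_eq_one_or σ₀ with h | h <;> simp [h]
    have h2 : σ * σ = 1 := by rcases hσ with rfl | rfl <;> simp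
    have hc : coef (-((σ₀ : ℤ) * σ)) 0 0 = -((σ₀ : ℤ) * σ) := by simp [coef]
    have e : (((-(σ₀ * sgnU σ)) : ℤˣ) : ℤ) * coef (-((σ₀ : ℤ) * σ)) 0 0 = ((σ₀ : ℤ) * (σ₀ : ℤ)) * (σ * σ) := by
      rw [hc, Units.val_neg, Units.val_mul, hs]; ring
    rw [e, h1, h2]; norm_num
  depth_iff := by
    intro v m
    have hx := hraw v
    unfold sdepth linForm
    rw [hx]
    rcases Int.units_eq_one_or σ₀ with h1 | h1 <;> subst h1
    · rw [if_pos Units.val_one, if_pos Units.val_one, Units.val_one]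
      constructor <;> intro hh <;> linarith
    · have hne : ¬ (((-1 : ℤˣ) : ℤ) = 1) := by simp
      rw [if_neg hne, if_neg hne, Units.val_neg, Units.val_one]
      constructor <;> intro hh <;> linarith

/-- **The level side form** of the side `(i, σ₀)` of a box in a frame whose coordinate `i` is `⌊σβ′/U⌋`: `L = ∓σβ′` (without its
constant), `θ` affine with slope `U`. [this work] -/
def levSide (ψ : V → Site 2) (c₀ : V) {n : ℕ} (hn : 1 ≤ n) (h σ : ℤ) (hσ : σ = 1 ∨ σ = -1) (Lo Hi : Site 2) (i : Fin 2) (σ₀ : ℤˣ)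
    (hlev : ∀ w, ψ w i = (σ * shearCoord φ c₀ n h w) / (shearUnit n h : ℤ)) : SideForm ψ φ Lo Hi i σ₀ where
  cα := (σ₀ : ℤ) * σ * h
  cβ := -((σ₀ : ℤ) * σ * n)
  θ := fun m => if (σ₀ : ℤ) = 1 then 1 - (Hi i - m + 1) * (shearUnit n h : ℤ) - σ * ((n : ℤ) * φ c₀ 1 - h * φ c₀ 0)
    else (m + Lo i) * (shearUnit n h : ℤ) + σ * ((n : ℤ) * φ c₀ 1 - h * φ c₀ 0)
  a := 1
  s := -(σ₀ * sgnU σ)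
  clim := by
    have hs := val_sgnU hσ
    have h1 : (σ₀ : ℤ) * (σ₀ : ℤ) = 1 := by rcases Int.units_eq_one_or σ₀ with h | h <;> simp [h]
    have h2 : σ * σ = 1 := by rcases hσ with rfl | rfl <;> simp
    have hn0 : (0 : ℤ) < n := by exact_mod_cast hn
    have hc : coef ((σ₀ : ℤ) * σ * h) (-((σ₀ : ℤ) * σ * n)) 1 = -((σ₀ : ℤ) * σ * n) := by simp [coef]
    have e : (((-(σ₀ * sgnU σ)) : ℤˣ) : ℤ) * coef ((σ₀ : ℤ) * σ * h) (-((σ₀ : ℤ) * σ * n)) 1 = ((σ₀ : ℤ) * (σ₀ : ℤ)) * (σ * σ) * n := by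
      rw [hc, Units.val_neg, Units.val_mul, hs]; ring
    rw [e, h1, h2]; simpa using hn0
  depth_iff := by
    intro v m
    have hU := shearUnit_pos hn h
    unfold sdepth linForm
    rw [hlev v]
    set y := σ * shearCoord φ c₀ n h v with hy
    have eβ : ∀ e : ℤ, e * σ * h * φ v 0 + -(e * σ * n) * φ v 1 = -(e * y) - e * (σ * ((n : ℤ) * φ c₀ 1 - h * φ c₀ 0)) := by
      intro e; rw [hy, shearCoord_apply]; ring
    rcases Int.units_eq_one_or σ₀ with h1 | h1 <;> subst h1
    · rw [if_pos Units.val_one, if_pos Units.val_one, Units.val_one, eβ 1]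
      constructor
      · intro hm
        have hle : y / (shearUnit n h : ℤ) ≤ Hi i - m := by linarith
        have hlt : y < (Hi i - m + 1) * (shearUnit n h : ℤ) := by
          have := Int.lt_ediv_add_one_mul_self y hU
          nlinarith
        linarith
      · intro hm
        have hlt : y < (Hi i - m + 1) * (shearUnit n h : ℤ) := by linarith
        have : y / (shearUnit n h : ℤ) < Hi i - m + 1 := (Int.ediv_lt_iff_lt_mul hU).2 hlt
        linarith
    · have hne : ¬ (((-1 : ℤˣ) : ℤ) = 1) := by simp
      rw [if_neg hne, if_neg hne, Units.val_neg, Units.val_one, eβ (-1)]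
      constructor
      · intro hm
        have hle : m + Lo i ≤ y / (shearUnit n h : ℤ) := by linarith
        have := (Int.le_ediv_iff_mul_le hU).1 hle
        linarith
      · intro hm
        have hle : (m + Lo i) * (shearUnit n h : ℤ) ≤ y := by linarith
        have := (Int.le_ediv_iff_mul_le hU).2 hle
        linarith

/-- **The four side forms of a box of the x-run frame** (`σ = ±1`, `1 ≤ n`). [this work] -/
def runXSide (c₀ : V) {n : ℕ} (hn : 1 ≤ n) (h : ℤ) {σ : ℤ} (hσ : σ = 1 ∨ σ = -1) (Lo Hi : Site 2) :
    ∀ (i : Fin 2) (σ₀ : ℤˣ), SideForm (runX φ c₀ n h σ) φ Lo Hi i σ₀ := fun i σ₀ =>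
  if hi : i = 0 then hi ▸ rawSide (runX φ c₀ n h σ) c₀ σ hσ Lo Hi 0 σ₀ (fun w => by rw [runX_zero, relCoord_apply])
  else (eq_oth_of_ne hi : i = oth 0) ▸ levSide (runX φ c₀ n h σ) c₀ hn h σ hσ Lo Hi 1 σ₀ (fun w => by rw [runX_one])

/-- **The four side forms of a box of the y′-run frame.** [this work] -/
def runYSide (c₀ : V) {n : ℕ} (hn : 1 ≤ n) (h : ℤ) {σ : ℤ} (hσ : σ = 1 ∨ σ = -1) (Lo Hi : Site 2) :
    ∀ (i : Fin 2) (σ₀ : ℤˣ), SideForm (runY φ c₀ n h σ) φ Lo Hi i σ₀ := fun i σ₀ =>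
  if hi : i = 0 then hi ▸ levSide (runY φ c₀ n h σ) c₀ hn h σ hσ Lo Hi 0 σ₀ (fun w => by rw [runY_zero])
  else (eq_oth_of_ne hi : i = oth 0) ▸ rawSide (runY φ c₀ n h σ) c₀ σ hσ Lo Hi 1 σ₀ (fun w => by rw [runY_one, relCoord_apply])

/-! ## §2 `Compat`-type control of the run frames by the base chart -/

/-- **A `φ`-box of radius `d` moves the x-run frame by at most `d + 1`.** [folklore] -/
theorem compat_runX {n : ℕ} (hn : 1 ≤ n) (c₀ : V) (h : ℤ) {σ : ℤ} (hσ : σ = 1 ∨ σ = -1) :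
    ∀ (v w : V) (d : ℕ), φ v - φ w ∈ box 2 d → ∀ i, |runX φ c₀ n h σ v i - runX φ c₀ n h σ w i| ≤ d + 1 := by
  intro v w d hvw i
  rw [mem_box] at hvw
  have h0 : |φ v 0 - φ w 0| ≤ d := by have := hvw 0; simp only [Pi.sub_apply] at this; exact abs_le.2 ⟨this.1, this.2⟩
  have h1 : |φ v 1 - φ w 1| ≤ d := by have := hvw 1; simp only [Pi.sub_apply] at this; exact abs_le.2 ⟨this.1, this.2⟩
  obtain ⟨ha, hb⟩ := runX_disp_of_φ hn c₀ h hσ h0 h1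
  fin_cases i
  · exact ha.trans (by linarith)
  · exact hb

/-- **A `φ`-box of radius `d` moves the y′-run frame by at most `d + 1`.** [folklore] -/
theorem compat_runY {n : ℕ} (hn : 1 ≤ n) (c₀ : V) (h : ℤ) {σ : ℤ} (hσ : σ = 1 ∨ σ = -1) :
    ∀ (v w : V) (d : ℕ), φ v - φ w ∈ box 2 d → ∀ i, |runY φ c₀ n h σ v i - runY φ c₀ n h σ w i| ≤ d + 1 := by
  intro v w d hvw i
  rw [mem_box] at hvw
  have h0 : |φ v 0 - φ w 0| ≤ d := by have := hvw 0; simp only [Pi.sub_apply] at this; exact abs_le.2 ⟨this.1, this.2⟩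
  have h1 : |φ v 1 - φ w 1| ≤ d := by have := hvw 1; simp only [Pi.sub_apply] at this; exact abs_le.2 ⟨this.1, this.2⟩
  obtain ⟨ha, hb⟩ := runY_disp_of_φ hn c₀ h hσ h0 h1
  fin_cases i
  · exact ha
  · exact hb.trans (by linarith)

end Skelφ

end Summit.CriticalPhenomena.PercolationContinuityZ3.Theorems.Transplant

end
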